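import Mathlib

/-!
# The small-swirl corner `b → 0⁺` of the linearised cone problem: algebraic skeleton (K22)

Solo seat `solo-NavierStokesRegularity-informed`, session 13; companion of
`paper/swirling-cone-linearisation.md` §5e (Proposition 12). At the swirling cones
`A_b = diag(-1/2,-1/2,1) + b J` the mode-`m` linearised system has, at the equator, the singular block
`M₁₁ = (2/3) b N_m`, `N_m = [[-i m, 2], [-2, -i m]]`, which degenerates as `b → 0`. The equator-analytic
solutions are parametrised by `(w, q)(π/2)`, with `(a, c)(π/2) = -M₁₁⁻¹ M₁₂ (w, q)(π/2)` and
`M₁₂ (0, 1) = -(2/3) (2, i m)` at `b = 0`; hence the `q`-datum solution has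
`(a, c)(π/2) = b⁻¹ (m² - 4)⁻¹ t_m + O(1)` with the CORNER DIRECTION `t_m = (4 i m, -(4 + m²))`
(`corner_direction`), and the rescaled equator-analytic space converges, as `b → 0⁺`, to the `b = 0`
solutions with equator data in `span{(0,0,1,0), (t_m, 0, 0)}`. On the other side, at `b = 0` the
smooth polar germ of mode `m`, `|m| ≥ 3`, is the gradient of the solid Legendre function
`r² F_m(φ) e^{i m α}`, whose equator datum is `(2 F_m(π/2), i m F_m(π/2), F_m'(π/2), 0)` with
`F_m(π/2) = ₂F₁(-2, 3; m + 1; 1/2) / m! = (m - 1) / ((m + 2) m!) ≠ 0` (`legendre2_equator_value`).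
The two `(a, c)`-directions `(2, i m)` and `t_m` are transversal exactly when `m² ≠ 4`
(`corner_transversal`): the limit residual `res(m, 0⁺)` is positive for every `|m| ≥ 3`, and by
continuity in `b` there is no smooth mode-`m` linearised solution for `0 < |b| < b₀(m)`.
No new definitions; axioms: standard.
-/

namespace Summit.NavierStokesRegularity.NavierStokesRegularity.Theorems

open Complex

/-- The corner direction: `N_m t_m = (m² - 4) (2, i m)` for `N_m = [[-i m, 2], [-2, -i m]]` and
`t_m = (4 i m, -(4 + m²))`, i.e. `t_m = (m² - 4) N_m⁻¹ (2, i m)` whenever `m² ≠ 4`. -/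
theorem corner_direction (m : ℂ) :
    Matrix.mulVec !![-(I * m), 2; -2, -(I * m)] ![4 * I * m, -(4 + m ^ 2)]
      = (m ^ 2 - 4) • ![2, I * m] := by
  ext i
  fin_cases i
  · simp [Matrix.mulVec, Matrix.vecHead, Matrix.vecTail]
    linear_combination (-4 * m ^ 2) * Complex.I_sq
  · simp [Matrix.mulVec, Matrix.vecHead, Matrix.vecTail]
    ring

/-- Transversality of the two equator directions: `det [ (2, i m) ; t_m ] = 2 (m² - 4)`, non-zero
exactly off the strain resonance `m = ±2`. -/
theorem corner_transversal (m : ℂ) :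
    Matrix.det !![2, I * m; 4 * I * m, -(4 + m ^ 2)] = 2 * (m ^ 2 - 4) := by
  rw [Matrix.det_fin_two_of]
  linear_combination (-4 * m ^ 2) * Complex.I_sq

/-- Off the strain resonance `m² ≠ 4` the two equator directions are linearly independent. -/
theorem corner_transversal_ne_zero {m : ℂ} (hm : m ^ 2 ≠ 4) :
    Matrix.det !![2, I * m; 4 * I * m, -(4 + m ^ 2)] ≠ 0 := by
  rw [corner_transversal]
  exact mul_ne_zero two_ne_zero (sub_ne_zero.mpr hm)

/-- The value of the degree-2 Legendre function of order `m` at the equator, up to the factor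
`1 / m!`: the terminating hypergeometric sum `₂F₁(-2, 3; m + 1; 1/2) =
1 - (6/(m+1))(1/2) + (12/((m+1)(m+2)))(1/2)² = (m - 1)/(m + 2)`, non-zero for `m ≠ 1`. -/
theorem legendre2_equator_value (m : ℂ) (h1 : m + 1 ≠ 0) (h2 : m + 2 ≠ 0) :
    1 - 6 / (m + 1) * (1 / 2) + 12 / ((m + 1) * (m + 2)) * (1 / 2) ^ 2 = (m - 1) / (m + 2) := by
  field_simp
  ring

/-- Hence `F_m(π/2) ≠ 0` for every order `m ∉ {-2, -1, 1}`, in particular for all `|m| ≥ 3`. -/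
theorem legendre2_equator_value_ne_zero {m : ℂ} (h1 : m + 1 ≠ 0) (h2 : m + 2 ≠ 0) (h3 : m ≠ 1) :
    1 - 6 / (m + 1) * (1 / 2) + 12 / ((m + 1) * (m + 2)) * (1 / 2) ^ 2 ≠ 0 := by
  rw [legendre2_equator_value m h1 h2]
  exact div_ne_zero (sub_ne_zero.mpr h3) h2

/-- At `b = 0` the leading equator matrix `H₀(0)` (unknowns `(a, c, w, q)`) is
`[[0, M₁₂], [0, 0]]` with `M₁₂ = [[0, -4/3], [0, -(2/3) i m]]`: it squares to zero, so `j - H₀(0)` is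
invertible for every `j ≥ 1` (no resonance obstruction) and its kernel is `{q = 0}`. -/
theorem corner_equator_nilpotent (m : ℂ) :
    (!![0, 0, 0, -(4/3 : ℂ); 0, 0, 0, -((2/3) * I * m); 0, 0, 0, 0; 0, 0, 0, 0]) ^ 2 = 0 := by
  ext i j
  fin_cases i <;> fin_cases j <;> simp [pow_two, Matrix.mul_apply, Fin.sum_univ_four]

/-- The kernel of `H₀(0)` is the hyperplane `{q = 0}`: the `b = 0` equator-analytic solutions form a
3-parameter family indexed by `(a, c, w)(π/2)`. -/
theorem corner_equator_kernel (m : ℂ) (a c w q : ℂ) :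
    Matrix.mulVec !![0, 0, 0, -(4/3 : ℂ); 0, 0, 0, -((2/3) * I * m); 0, 0, 0, 0; 0, 0, 0, 0]
      ![a, c, w, q] = 0 ↔ q = 0 := by
  constructor
  · intro h
    have h0 := congrFun h 0
    simp [Matrix.mulVec, Matrix.vecHead, Matrix.vecTail] at h0
    exact h0
  · intro hq
    subst hq
    ext i
    fin_cases i <;> simp [Matrix.mulVec, Matrix.vecHead, Matrix.vecTail]

end Summit.NavierStokesRegularity.NavierStokesRegularity.Theorems
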